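import Summits.Ventures.HSemireg.Pad4TowerB1OddBoostBlind

/-!
# Cruxes ∕ BlochSeedDiscOne — `A2I⁻` IS VACUOUS ON EVERY CEILING-LINE SUPPORT (LINE 6 «ceiling-line game», general lemma; negation lens g6, director R19.27 (2)(α))

HONEST FRAMING. Lens seat `plan-lens-HodgeAV-negation` (director-hodge req-36), crux of record stmt-HodgeConjecture-18881 `BlochSeedDiscOne`
(skeleton `Lines/birth.lean` 814a6a70c14e831a UNTOUCHED). This file is pure LOGIC about the typed static family `A2IMinusClosed`
(`Pad4TowerXresFamilies.XresA2IClosed`) of the tree: no `decide` on data, no `sorry`, no `axiom`, no `instance`, no notation, no Literature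
fact, no new `def … : Prop`. NOTHING HERE SAYS THAT HC ∕ HC_CM ∕ HC_AV ∕ H2 ∕ 18881 ∕ (T_h) HOLDS OR FAILS.

THE LEMMA (`a2iMinusClosed_of_onCeiling`). If a two-level configuration `C` lies in the diamond ◇_h and EVERY letter of EVERY cell of both
levels lies on the ceiling line `α + |charge| = h` (`Pad4TowerFCCore.OnCeiling h`), then `A2IMinusClosed C` holds VACUOUSLY: an instance
`XresA2IFires C Z q N' σ u f' v` needs `¬ isApex (Z σ)`, `EncDir (Z σ) u` and `UPartner Z q σ u` with `q ∈ C.upper`, i.e. the partner letter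
`q σ = Z σ − e·(1, n_u)` strictly DOWN `Z σ`'s own encoding ray (`e ≥ 1`); its causal height is `(α − e) + (c − e) < α + c = h` because
`c = cabs (Z σ) ≥ 1` and `α ≥ 0` inside the diamond — so `q σ` is OFF the line, contradiction. (In the dual world `α < 0` and `EncDir`'s second
disjunct sends the partner UP the line, so the dual family `A2I⁺` is NOT vacuous on line supports — consistent with the anomaly lens's 5 088 typed
`A2I⁺`-instances on the ι₁₂-dual of the L12 design, bus l.34982; only `A2I⁻` is.) This is s4-search-1's encoder observation «A2I⁻ contributes
0 clauses on the LINE-h alphabet» (kit j326579 ∕ j326707 stdout) as a THEOREM, for every h and every line support at once; every W-LINE kernel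
certificate (P-L6-4K v1.1, `CeilingLineCert*.lean`) closes its `A2I⁻` conjunct by this lemma instead of a decide (at 1 585 cells that decide
alone was ≈ 2.2 farm-hours).

ALSO HERE (format v1.1 logic, reused verbatim by the certificates): `xresXClosed_iff_guarded'` (the `X` family with the apex, partner and
sibling guards hoisted — same statement, cheaper decide) and `swapClosed_of_gens` (closure of a level under the three adjacent transpositions
gives closure under all transpositions, the hypothesis of `Pad4TowerPermWindow.permClosed_of_swapClosed`).
-/

set_option linter.dupNamespace false

namespace Summit.HodgeConjecture.HodgeConjecture.Cruxes.BlochSeedDiscOne.CeilingLine.A2IVacuous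

open Summit.Ventures.HSemireg Summit.Ventures.HSemireg.Pad4Tower

/-- the four unit phase steps, as values of the two direction tables of `ray`. -/
theorem stepVals (k : Fin 4) :
    (![(1:ℤ), 0, -1, 0] k = 1 ∧ ![(0:ℤ), -1, 0, 1] k = 0) ∨ (![(1:ℤ), 0, -1, 0] k = 0 ∧ ![(0:ℤ), -1, 0, 1] k = -1) ∨
      (![(1:ℤ), 0, -1, 0] k = -1 ∧ ![(0:ℤ), -1, 0, 1] k = 0) ∨ (![(1:ℤ), 0, -1, 0] k = 0 ∧ ![(0:ℤ), -1, 0, 1] k = 1) := by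
  fin_cases k <;> decide

/-- **`A2I⁻` IS VACUOUS ON A LINE SUPPORT.** If `C ⊂ ◇_h` and every letter of every cell of both levels lies on the ceiling line
`α + |charge| = h`, then the `A2I` family has no instance on `C`, so `A2IMinusClosed C`. -/
theorem a2iMinusClosed_of_onCeiling (C : MConfig) (h : ℤ) (hD : C.InDiamond h)
    (hN : ∀ Z ∈ C.lower, ∀ f, OnCeiling h (Z f)) (hP : ∀ P ∈ C.upper, ∀ f, OnCeiling h (P f)) :
    A2IMinusClosed C := by
  intro Z hZ q hq N' _ σ u f' v hF
  have hα : 0 ≤ (Z σ).1 := (inDiamond_bounds (hD.1 Z hZ σ)).1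
  have hapex : ¬ isApex (Z σ) := hF.1
  have henc : EncDir (Z σ) u := hF.2.1
  have hup : (q σ).1 < (Z σ).1 ∧ Z σ = ray (q σ) u ((Z σ).1 - (q σ).1) := ⟨hF.2.2.1.2.1, hF.2.2.1.2.2⟩
  have hzl : OnCeiling h (Z σ) := hN Z hZ σ
  have hql : OnCeiling h (q σ) := hP q hq σ
  clear hF
  generalize hx : Z σ = x at hapex henc hup hzl hα
  generalize hy : q σ = y at hup hql
  obtain ⟨α, b1, b2⟩ := x
  obtain ⟨α', b1', b2'⟩ := y
  simp only [isApex, EncDir, OnCeiling, absCharge, chargeOf, cabs, ray, Prod.mk.injEq, not_and] at hapex henc hup hzl hql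
  have m1 := le_max_left |b1| |b2|
  have m2 := le_max_right |b1| |b2|
  rcases abs_cases b1 with ⟨a1, _⟩ | ⟨a1, _⟩ <;> rcases abs_cases b2 with ⟨a2, _⟩ | ⟨a2, _⟩ <;>
    rcases abs_cases (b1 - b2) with ⟨a3, _⟩ | ⟨a3, _⟩ <;> rcases abs_cases (b1' - b2') with ⟨a4, _⟩ | ⟨a4, _⟩ <;>
    rcases stepVals u with ⟨d1, d2⟩ | ⟨d1, d2⟩ | ⟨d1, d2⟩ | ⟨d1, d2⟩ <;>
    simp only [d1, d2, mul_one, mul_zero, mul_neg, add_zero, zero_add] at henc hup <;> omega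

/-- the same with the line hypothesis bundled as one conjunction (the shape `cfg_onLine` of the certificates ∕ LINE 6 `LineSupport h C`). -/
theorem a2iMinusClosed_of_lineSupport (C : MConfig) (h : ℤ) (hD : C.InDiamond h)
    (hL : (∀ Z ∈ C.lower, ∀ f, OnCeiling h (Z f)) ∧ ∀ P ∈ C.upper, ∀ f, OnCeiling h (P f)) : A2IMinusClosed C :=
  a2iMinusClosed_of_onCeiling C h hD hL.1 hL.2

/-- hence on a line support inside ◇_h, `StaticH1` reduces to its RULE D and X⁺ conjuncts. -/
theorem staticH1_of_lineSupport (C : MConfig) (h : ℤ) (hD : C.InDiamond h)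
    (hL : (∀ Z ∈ C.lower, ∀ f, OnCeiling h (Z f)) ∧ ∀ P ∈ C.upper, ∀ f, OnCeiling h (P f))
    (hR : RuleDMu4Closed C) (hX : XPlusClosed C) : C.StaticH1 :=
  ⟨hR, hX, a2iMinusClosed_of_lineSupport C h hD hL⟩

/-- the `X` family in GUARDED form: apex, partner and sibling guards hoisted (same statement; `XresXFires` begins with `¬ isApex (Z σ)`). -/
theorem xresXClosed_iff_guarded' (D : MConfig) : XresXClosed D ↔
    ∀ Z ∈ D.lower, ∀ σ : Fin 4, ¬ isApex (Z σ) → ∀ u : Fin 4, ∀ q ∈ D.upper, UPartner Z q σ u → ∀ w : Fin 4, ∀ n ∈ D.lower,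
      Sibling q n σ w → ∀ f : Fin 4, ¬ XresXFires D Z q n σ u w f := by
  constructor
  · intro h Z hZ σ _ u q hq _ w n hn _ f
    exact h Z hZ q hq n hn σ u w f
  · intro h Z hZ q hq n hn σ u w f hF
    exact h Z hZ σ hF.1 u q hq hF.2.2.1 w n hn hF.2.2.2.2.2.1 f hF

/-- every transposition of `Fin 4` is pointwise one of `(01) (12) (23) (02) (13) (03)`. [`decide`] -/
theorem swap_cases : ∀ x y : Fin 4, x ≠ y →
    (∀ z, Equiv.swap x y z = Equiv.swap 0 1 z) ∨ (∀ z, Equiv.swap x y z = Equiv.swap 1 2 z) ∨ (∀ z, Equiv.swap x y z = Equiv.swap 2 3 z) ∨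
    (∀ z, Equiv.swap x y z = Equiv.swap 0 2 z) ∨ (∀ z, Equiv.swap x y z = Equiv.swap 1 3 z) ∨ (∀ z, Equiv.swap x y z = Equiv.swap 0 3 z) := by
  decide

/-- S₄-closure of a level from closure under the THREE adjacent transpositions (the hypothesis of `permClosed_of_swapClosed` asks all
twelve ordered pairs; a certificate now decides three). -/
theorem swapClosed_of_gens {S : Finset MCell}
    (h01 : ∀ Z ∈ S, Z.perm (Equiv.swap 0 1) ∈ S) (h12 : ∀ Z ∈ S, Z.perm (Equiv.swap 1 2) ∈ S)
    (h23 : ∀ Z ∈ S, Z.perm (Equiv.swap 2 3) ∈ S) :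
    ∀ x y : Fin 4, x ≠ y → ∀ Z ∈ S, Z.perm (Equiv.swap x y) ∈ S := by
  have e02 : Equiv.swap (0 : Fin 4) 2 = Equiv.swap 0 1 * Equiv.swap 1 2 * Equiv.swap 0 1 := Equiv.ext (by decide)
  have e13 : Equiv.swap (1 : Fin 4) 3 = Equiv.swap 1 2 * Equiv.swap 2 3 * Equiv.swap 1 2 := Equiv.ext (by decide)
  have e03 : Equiv.swap (0 : Fin 4) 3 = Equiv.swap 0 1 * Equiv.swap 1 3 * Equiv.swap 0 1 := Equiv.ext (by decide)
  have h02 : ∀ Z ∈ S, Z.perm (Equiv.swap 0 2) ∈ S := fun Z hZ => by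
    rw [e02, MCell.perm_mul, MCell.perm_mul]; exact h01 _ (h12 _ (h01 Z hZ))
  have h13 : ∀ Z ∈ S, Z.perm (Equiv.swap 1 3) ∈ S := fun Z hZ => by
    rw [e13, MCell.perm_mul, MCell.perm_mul]; exact h12 _ (h23 _ (h12 Z hZ))
  have h03 : ∀ Z ∈ S, Z.perm (Equiv.swap 0 3) ∈ S := fun Z hZ => by
    rw [e03, MCell.perm_mul, MCell.perm_mul]; exact h01 _ (h13 _ (h01 Z hZ))
  intro x y hxy Z hZ
  rcases swap_cases x y hxy with e | e | e | e | e | e <;> rw [Equiv.ext e]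
  exacts [h01 Z hZ, h12 Z hZ, h23 Z hZ, h02 Z hZ, h13 Z hZ, h03 Z hZ]

/-- … and `PermClosed` itself. -/
theorem permClosed_of_gens {S : Finset MCell}
    (h01 : ∀ Z ∈ S, Z.perm (Equiv.swap 0 1) ∈ S) (h12 : ∀ Z ∈ S, Z.perm (Equiv.swap 1 2) ∈ S)
    (h23 : ∀ Z ∈ S, Z.perm (Equiv.swap 2 3) ∈ S) : PermClosed S :=
  permClosed_of_swapClosed (swapClosed_of_gens h01 h12 h23)

end Summit.HodgeConjecture.HodgeConjecture.Cruxes.BlochSeedDiscOne.CeilingLine.A2IVacuous
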